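import Mathlib
import HarnessLib

/-!
# Non-square descent — SQUARE CLASSES IN A QUADRATIC KUMMER STEP (stub S3 (a) of the line card `nonsquare-descent`) for the
# seed crux `SignedMuSeedAtTwoPlus` stmt-BirchSwinnertonDyer-21438 (parent Kμ⁺ `SignedMuVanishingAtTwoPlus` stmt-BirchSwinnertonDyer-20689,
# route ResidualThetaTransportAtTwo)

Cell `bsd-wall`, width seat `bsd-wall-rtt-p4-w2` g17 (`--supports`, closes nothing).  THEOREMS ONLY; BSD is not proved by this and no
number field is named: the statements are field algebra for an arbitrary quadratic extension `F'/F` and an arbitrary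
`ℤ`-valued valuation on `F`.

Stub S3 of `Cruxes/SignedMuSeedAtTwoPlus/Lines/nonsquare-descent.md` needs the arithmetic input (a): the layers of the cyclotomic
`ℤ₂`-tower of `M = ℚ(W[2])` are Kummer-explicit, `M_{n+1} = M_n(√α_n)` with `α_n = 2 + ζ_{2^{n+2}} + ζ_{2^{n+2}}⁻¹` of ODD valuation `3`
at the unique prime over `2`, «so `𝓔(M_n)/2 ↪ 𝓔(M_{n+1})/2`: a non-square unit stays a non-square forever, and one level certifies
the `Λ`-adic statement» (the injectivity `hι` of the squares-dichotomy engine, `Theorems/…NonsquareDescentEngine.lean`).  The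
field-level content is:

* §1 `linearIndependent_one_pair`, `exists_eq_add_mul_of_finrank_two` — in a quadratic extension `F'/F` (`finrank F F' = 2`) with
  `s ∉ F`, every element is `a + b·s` with `a b ∈ F`.
* §2 `sq_descent_quadratic` — if `s² = α ∈ F` and `s ∉ F`, an `x ∈ F` with `x = (a + b s)²` is `a²` or `α b²` in `F`
  (`2ab = 0` since `2ab·s = x − a² − α b² ∈ F`; needs `2 ≠ 0` in `F`).  Adapted from `Cruxes/SignedMuSeedAtTwoPlus/NonsquareDescentSketch.lean`
  (k2 g28), same statement; `eq_sq_or_eq_mul_sq_of_isSquare_algebraMap` packages §1 + §2: `x` a square in `F'` ⇒ `x = a²` or `x = α b²`.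
* §3 `ne_mul_sq_of_odd_valuation` — for a valuation `v : F → ℤᵐ⁰`, if `v α` has ODD exponent and `v x` has EVEN exponent (e.g. `x` a
  unit, exponent `0`) then `x ≠ α b²` for every `b` (parity of `v`); `not_mem_range_algebraMap_of_odd_valuation` — such an `α` is not a
  square in `F`, so `s ∉ F` is automatic.
* §4 **`isSquare_of_isSquare_algebraMap_of_odd_valuation`** — THE INJECTIVITY `Fˣ/2 ↪ F'ˣ/2` ON EVEN-VALUATION CLASSES: in
  `F' = F(√α)` with `v(α)` odd and `2 ≠ 0`, an element of `F` of even valuation which becomes a square in `F'` was already a square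
  in `F`; contrapositive `not_isSquare_algebraMap_of_not_isSquare` («a non-square unit of `M_n` stays a non-square in `M_{n+1}`»).

Dictionary: `F = M_n`, `F' = M_{n+1}`, `s = √α_n`, `v` = the `𝔓`-adic valuation of `M_n` at its unique prime over `2`
(`v(α_n) = 3`), `x` a unit (`v x` of exponent `0`).  [folklore]
-/

set_option autoImplicit false
-- the Theorems namespace of this sub repeats the summit name by design (D-0017 nested layout)
set_option linter.dupNamespace false

namespace Summit.BirchSwinnertonDyer.BirchSwinnertonDyer.Theorems.SignedMuAtTwo.NonsquareDescent

/-! ## §1 Quadratic extensions: every element is `a + b s` -/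

section Quadratic

variable {F F' : Type*} [Field F] [Field F'] [Algebra F F']

/-- `1` and an element `s ∉ F` are linearly independent over `F`. [folklore] -/
theorem linearIndependent_one_pair {s : F'} (hnot : s ∉ Set.range (algebraMap F F')) :
    LinearIndependent F ![(1 : F'), s] := by
  rw [LinearIndependent.pair_iff]
  intro a b hab
  by_cases hb : b = 0
  · subst hb
    rw [zero_smul, add_zero, Algebra.smul_def, mul_one, map_eq_zero_iff _ (algebraMap F F').injective] at hab
    exact ⟨hab, rfl⟩
  · exfalso
    apply hnot
    refine ⟨-a / b, ?_⟩
    rw [Algebra.smul_def, mul_one, Algebra.smul_def] at hab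
    rw [map_div₀, map_neg, div_eq_iff ((map_ne_zero_iff _ (algebraMap F F').injective).mpr hb)]
    linear_combination (-1 : F') * hab

/-- In a quadratic extension `F'/F` (`finrank F F' = 2`) with `s ∉ F`, every element of `F'` is `a + b·s` with `a b ∈ F`.
[folklore] -/
theorem exists_eq_add_mul_of_finrank_two (h2 : Module.finrank F F' = 2) {s : F'}
    (hnot : s ∉ Set.range (algebraMap F F')) (y : F') :
    ∃ a b : F, y = algebraMap F F' a + algebraMap F F' b * s := by
  haveI : Module.Finite F F' := Module.finite_of_finrank_pos (by omega)
  have hli := linearIndependent_one_pair hnot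
  have hcard : Fintype.card (Fin 2) = Module.finrank F F' := by rw [Fintype.card_fin, h2]
  let B := basisOfLinearIndependentOfCardEqFinrank hli hcard
  obtain ⟨c, hc⟩ : ∃ c : Fin 2 → F, y = c 0 • (1 : F') + c 1 • s := by
    refine ⟨B.repr y, ?_⟩
    have hsum := B.sum_repr y
    rw [Fin.sum_univ_two] at hsum
    have h0 : B 0 = 1 := by simp [B]
    have h1 : B 1 = s := by simp [B]
    rw [h0, h1] at hsum
    exact hsum.symm
  exact ⟨c 0, c 1, by rw [hc, Algebra.smul_def, mul_one, Algebra.smul_def]⟩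

end Quadratic

/-! ## §2 Quadratic square descent -/

section Descent

variable {F F' : Type*} [Field F] [Field F'] [Algebra F F']

/-- **Quadratic square descent** (identity form).  In `F' ⊇ F` with `s² = α ∈ F`, `s ∉ F` and `2 ≠ 0` in `F`: an element `x ∈ F`
with `x = (a + b s)²` (`a b ∈ F`) is `a²` or `α b²` in `F`.  Adapted from `Cruxes/SignedMuSeedAtTwoPlus/NonsquareDescentSketch.lean`
(`sq_descent_quadratic`, k2 g28). [folklore] -/
theorem sq_descent_quadratic [NeZero (2 : F)] (α : F) (s : F') (hs : s ^ 2 = algebraMap F F' α)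
    (hnot : s ∉ Set.range (algebraMap F F'))
    (x a b : F) (hx : algebraMap F F' x = (algebraMap F F' a + algebraMap F F' b * s) ^ 2) :
    x = a ^ 2 ∨ x = α * b ^ 2 := by
  have key : algebraMap F F' (2 * a * b) * s = algebraMap F F' (x - a ^ 2 - α * b ^ 2) := by
    simp only [map_sub, map_mul, map_pow, map_ofNat]
    linear_combination (-1 : F') * hx - (algebraMap F F' b) ^ 2 * hs
  by_cases hab : 2 * a * b = 0
  · rw [hab, map_zero, zero_mul, eq_comm, map_eq_zero_iff _ (algebraMap F F').injective] at key
    rcases mul_eq_zero.mp hab with h2a | hb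
    · rcases mul_eq_zero.mp h2a with h2 | ha
      · exact absurd h2 (NeZero.ne 2)
      · right; rw [ha] at key; linear_combination key
    · left; rw [hb] at key; linear_combination key
  · exfalso
    apply hnot
    refine ⟨(x - a ^ 2 - α * b ^ 2) / (2 * a * b), ?_⟩
    rw [map_div₀, ← key, mul_div_cancel_left₀]
    exact (map_ne_zero_iff _ (algebraMap F F').injective).mpr hab

/-- **Quadratic square descent** (square-class form): in a quadratic extension `F' = F(s)`, `s² = α`, `s ∉ F`, `2 ≠ 0`, an
`x ∈ F` that is a square in `F'` satisfies `x = a²` or `x = α b²` for some `a`, `b ∈ F`. [folklore] -/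
theorem eq_sq_or_eq_mul_sq_of_isSquare_algebraMap [NeZero (2 : F)] (h2 : Module.finrank F F' = 2) (α : F) (s : F')
    (hs : s ^ 2 = algebraMap F F' α) (hnot : s ∉ Set.range (algebraMap F F')) (x : F)
    (hx : IsSquare (algebraMap F F' x)) :
    (∃ a : F, x = a ^ 2) ∨ ∃ b : F, x = α * b ^ 2 := by
  obtain ⟨y, hy⟩ := hx
  obtain ⟨a, b, rfl⟩ := exists_eq_add_mul_of_finrank_two h2 hnot y
  rw [← sq] at hy
  rcases sq_descent_quadratic α s hs hnot x a b hy with h | h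
  · exact Or.inl ⟨a, h⟩
  · exact Or.inr ⟨b, h⟩

end Descent

/-! ## §3 Parity of a valuation -/

section Parity

variable {F : Type*} [Field F]

/-- **Parity obstruction**: for a valuation `v : F → ℤᵐ⁰`, if `v α` has odd exponent and `v x` has even exponent then `x ≠ α b²`
for every `b`. [folklore] -/
theorem ne_mul_sq_of_odd_valuation (v : Valuation F (WithZero (Multiplicative ℤ))) {α x : F} {kα kx : ℤ}
    (hα : v α = ((Multiplicative.ofAdd kα : Multiplicative ℤ) : WithZero (Multiplicative ℤ))) (hkα : Odd kα)
    (hx : v x = ((Multiplicative.ofAdd kx : Multiplicative ℤ) : WithZero (Multiplicative ℤ))) (hkx : Even kx)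
    (b : F) : x ≠ α * b ^ 2 := by
  intro h
  by_cases hb : b = 0
  · rw [hb, zero_pow two_ne_zero, mul_zero] at h
    rw [h, map_zero] at hx
    exact WithZero.coe_ne_zero hx.symm
  · have hvb : v b ≠ 0 := fun h0 => hb ((Valuation.zero_iff v).mp h0)
    obtain ⟨kb, hkb⟩ := WithZero.ne_zero_iff_exists.mp hvb
    have hval : v x = v α * v b ^ 2 := by rw [h, map_mul, map_pow]
    rw [hx, hα, ← hkb, ← WithZero.coe_pow, ← WithZero.coe_mul, WithZero.coe_inj] at hval
    have hint : kx = kα + 2 • Multiplicative.toAdd kb := by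
      apply Multiplicative.ofAdd.injective
      rw [ofAdd_add, ofAdd_nsmul, ofAdd_toAdd]
      exact hval
    rw [nsmul_eq_mul] at hint
    push_cast at hint
    obtain ⟨r, hr⟩ := hkα
    obtain ⟨t, ht⟩ := hkx
    omega

/-- An element of odd valuation is not a square: `s² = α` forces `s ∉ F` (so the hypothesis `s ∉ F` of §1–§2 is automatic in the
Kummer step `F' = F(√α)`, `v(α)` odd). [folklore] -/
theorem not_mem_range_algebraMap_of_odd_valuation {F' : Type*} [Field F'] [Algebra F F']
    (v : Valuation F (WithZero (Multiplicative ℤ))) {α : F} {kα : ℤ}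
    (hα : v α = ((Multiplicative.ofAdd kα : Multiplicative ℤ) : WithZero (Multiplicative ℤ))) (hkα : Odd kα)
    {s : F'} (hs : s ^ 2 = algebraMap F F' α) : s ∉ Set.range (algebraMap F F') := by
  rintro ⟨c, rfl⟩
  rw [← map_pow, (algebraMap F F').injective.eq_iff] at hs
  -- `hs : c ^ 2 = α`; the valuation of `c ^ 2` has even exponent
  by_cases hc : c = 0
  · rw [hc, zero_pow two_ne_zero] at hs
    rw [← hs, map_zero] at hα
    exact WithZero.coe_ne_zero hα.symm
  · have hvc : v c ≠ 0 := fun h0 => hc ((Valuation.zero_iff v).mp h0)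
    obtain ⟨kc, hkc⟩ := WithZero.ne_zero_iff_exists.mp hvc
    have hsq : v (c ^ 2) = ((Multiplicative.ofAdd (2 • Multiplicative.toAdd kc) : Multiplicative ℤ) :
        WithZero (Multiplicative ℤ)) := by
      rw [map_pow, ← hkc, ← WithZero.coe_pow, ofAdd_nsmul, ofAdd_toAdd]
    exact ne_mul_sq_of_odd_valuation v hα hkα hsq ⟨_, two_nsmul _⟩ 1 (by rw [one_pow, mul_one, hs])

end Parity

/-! ## §4 The injectivity `Fˣ/2 ↪ F'ˣ/2` on even-valuation classes -/

section Injectivity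

variable {F F' : Type*} [Field F] [Field F'] [Algebra F F']

/-- **A unit square class does not capitulate in a Kummer step of odd valuation.**  Let `F'/F` be quadratic, `s ∈ F'` with
`s² = α ∈ F`, `v` a `ℤ`-valued valuation of `F` with `v(α)` of ODD exponent, `2 ≠ 0` in `F`.  If `x ∈ F` has EVEN valuation exponent
(e.g. `x` a `v`-unit) and becomes a square in `F'`, then `x` is a square in `F`.  (By §2 `x = a²` or `x = α b²`; the second is excluded
by parity, §3.)  This is input (a) of stub S3: `𝓔(M_n)/2 ↪ 𝓔(M_{n+1})/2` for `M_{n+1} = M_n(√α_n)`, `v_𝔓(α_n) = 3`. [folklore] -/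
theorem isSquare_of_isSquare_algebraMap_of_odd_valuation [NeZero (2 : F)] (h2 : Module.finrank F F' = 2)
    (v : Valuation F (WithZero (Multiplicative ℤ))) {α : F} {kα : ℤ}
    (hα : v α = ((Multiplicative.ofAdd kα : Multiplicative ℤ) : WithZero (Multiplicative ℤ))) (hkα : Odd kα)
    {s : F'} (hs : s ^ 2 = algebraMap F F' α) {x : F} {kx : ℤ}
    (hx : v x = ((Multiplicative.ofAdd kx : Multiplicative ℤ) : WithZero (Multiplicative ℤ))) (hkx : Even kx)
    (hsq : IsSquare (algebraMap F F' x)) : IsSquare x := by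
  have hnot := not_mem_range_algebraMap_of_odd_valuation v hα hkα hs
  rcases eq_sq_or_eq_mul_sq_of_isSquare_algebraMap h2 α s hs hnot x hsq with ⟨a, ha⟩ | ⟨b, hb⟩
  · exact ⟨a, by rw [ha, sq]⟩
  · exact absurd hb (ne_mul_sq_of_odd_valuation v hα hkα hx hkx b)

/-- Contrapositive of `isSquare_of_isSquare_algebraMap_of_odd_valuation`: **a non-square of even valuation stays a non-square in
`F(√α)`, `v(α)` odd** — «a non-square elliptic unit stays a non-square forever» up the Kummer-explicit cyclotomic `2`-tower.
[folklore] -/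
theorem not_isSquare_algebraMap_of_not_isSquare [NeZero (2 : F)] (h2 : Module.finrank F F' = 2)
    (v : Valuation F (WithZero (Multiplicative ℤ))) {α : F} {kα : ℤ}
    (hα : v α = ((Multiplicative.ofAdd kα : Multiplicative ℤ) : WithZero (Multiplicative ℤ))) (hkα : Odd kα)
    {s : F'} (hs : s ^ 2 = algebraMap F F' α) {x : F} {kx : ℤ}
    (hx : v x = ((Multiplicative.ofAdd kx : Multiplicative ℤ) : WithZero (Multiplicative ℤ))) (hkx : Even kx)
    (hnsq : ¬ IsSquare x) : ¬ IsSquare (algebraMap F F' x) :=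
  fun hsq => hnsq (isSquare_of_isSquare_algebraMap_of_odd_valuation h2 v hα hkα hs hx hkx hsq)

end Injectivity

end Summit.BirchSwinnertonDyer.BirchSwinnertonDyer.Theorems.SignedMuAtTwo.NonsquareDescent
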